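import Literature.Geometry.GeometricMeasureTheory.MassComplete
import Literature.Geometry.GeometricMeasureTheory.CurrentsNullSupport
import Literature.Geometry.GeometricMeasureTheory.DilationInvariance
import HarnessLib

/-!
# Gluing locally given rectifiable data

For the currents of integration `[W, θ, ξ]` with admissible data (`IsRectifiableData`, Federer
4.1.28 (4)) of `Literature.Geometry.GeometricMeasureTheory.Currents` on an open subset `U` of a
finite-dimensional real inner product space `V`:

* `Current.notMem_support_of_forall_apply_eq_zero` — a current vanishing on all test forms
  supported in an open set `O` has no support in `O`;
* `ae_indicator_eq_of_currentOfIntegration_apply_eq` — **the density of a current of integration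
  is determined almost everywhere, locally**: if `[W₁, θ₁, ξ₁](φ) = [W₂, θ₂, ξ₂](φ)` for all test
  forms supported in an open `O ⊆ U`, then `1_{W₁} θ₁ ξ₁ = 1_{W₂} θ₂ ξ₂` (`ξ = ξ₁ ∧ ⋯ ∧ ξₘ`) at
  `𝓗^m`-almost every point of `O` (Federer's "`‖T‖(U ∼ spt T) = 0`",
  `ae_eq_zero_of_mem_sdiff_support_vectorCurrent`, applied to the difference);
* `Current.exists_isRectifiableData_of_locally` — **gluing**: let `T` be a current on `U` and
  `W ⊆ U` measurable; if every point of `W` has an open neighbourhood `O` and admissible data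
  `(W ∩ O, θ_O, ξ_O)` on `U` with `T(φ) = [W ∩ O, θ_O, ξ_O](φ)` for `spt φ ⊆ O`, and every point of
  `U ∖ W` has an open neighbourhood, disjoint from `W`, on whose test forms `T` vanishes, then
  `T = [W, θ, ξ]` for ONE admissible triple on `U` (so `T ∈ 𝓡^{loc}_m(U)`), whose density agrees
  almost everywhere on each `W ∩ O` with the local one. (Federer's definition 4.1.24 of `𝓡^{loc}`
  is local; this is its equivalence with the integral representation 4.1.28 (4) in the form the
  tree uses: a countable subcover by Lindelöf, a disjoint Borel refinement, uniqueness on the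
  overlaps, locality of approximate tangent cones `approxTangentCone_restrict_inter_eq_of_isOpen`.)

Theorems only; no definitions, no named facts.

## References

* H. Federer, *Geometric Measure Theory*, Springer 1969, 3.2.14, 4.1.5, 4.1.7, 4.1.24, 4.1.28
  [Federer1969].
* L. Simon, *Lectures on Geometric Measure Theory*, ANU 1983, §27 (integer multiplicity currents)
  [Simon1983].
-/

noncomputable section

open scoped ENNReal NNReal Topology
open MeasureTheory TopologicalSpace Set Filter Function

namespace Literature.Geometry.GeometricMeasureTheory

-- Nested operator-norm instances on (duals of) `V [⋀^Fin m]→L[ℝ] ℝ`, as in `Currents.lean`.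
set_option maxSynthPendingDepth 3

/-! ### Support and local vanishing -/

section Support

variable {E : Type*} [NormedAddCommGroup E] [NormedSpace ℝ E] {Ω : Opens E} {m : ℕ}

/-- A current vanishing on all test forms supported in an open set `O` has no support in `O`.
[cite: Federer1969, 4.1.1] -/
theorem Current.notMem_support_of_forall_apply_eq_zero (T : Current Ω m) {O : Set E}
    (hO : IsOpen O) (h : ∀ φ : TestForm Ω m, tsupport ⇑φ ⊆ O → T φ = 0) {x : E} (hx : x ∈ O) :
    x ∉ T.support := by
  intro hxT
  obtain ⟨φ, hφO, hφ⟩ := hxT.2 O (hO.mem_nhds hx)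
  exact hφ (h φ hφO)

end Support

/-! ### Uniqueness of the density -/

section Uniqueness

variable {V : Type*} [NormedAddCommGroup V] [InnerProductSpace ℝ V] [FiniteDimensional ℝ V]
  [MeasurableSpace V] [BorelSpace V] {U : Opens V} {m : ℕ}

/-- **The density of a current of integration is determined almost everywhere, locally.** If two
admissible triples on `U` give currents agreeing on all test forms supported in an open set `O`,
then their extended-by-zero densities `1_{Wᵢ} θᵢ ξᵢ₁ ∧ ⋯ ∧ ξᵢₘ` agree at `𝓗^m`-a.e. point of
`O ∩ U`. [cite: Federer1969, 4.1.5, 4.1.7, 4.1.28 (4)] -/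
theorem ae_indicator_eq_of_currentOfIntegration_apply_eq {O : Set V} (hO : IsOpen O)
    {W₁ W₂ : Set V} {θ₁ θ₂ : V → ℤ} {ξ₁ ξ₂ : V → Fin m → V}
    (h₁ : IsRectifiableData U m W₁ θ₁ ξ₁) (h₂ : IsRectifiableData U m W₂ θ₂ ξ₂)
    (h : ∀ φ : TestForm U m, tsupport ⇑φ ⊆ O →
      currentOfIntegration W₁ θ₁ ξ₁ φ = currentOfIntegration W₂ θ₂ ξ₂ φ) :
    ∀ᵐ x ∂(μHE[m] : Measure V), x ∈ O → x ∈ (U : Set V) →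
      W₁.indicator (fun x => (θ₁ x : ℝ) • frameVector (ξ₁ x)) x =
        W₂.indicator (fun x => (θ₂ x : ℝ) • frameVector (ξ₂ x)) x := by
  set η₁ : V → Multivector V m := W₁.indicator fun x => (θ₁ x : ℝ) • frameVector (ξ₁ x) with hη₁
  set η₂ : V → Multivector V m := W₂.indicator fun x => (((-θ₂ x : ℤ) : ℝ)) • frameVector (ξ₂ x)
    with hη₂
  have hl₁ : LocallyIntegrableOn η₁ (U : Set V) (μHE[m] : Measure V) :=
    (locallyIntegrableOn_indicator_iff h₁.1).2 h₁.2.2.2.1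
  have hl₂ : LocallyIntegrableOn η₂ (U : Set V) (μHE[m] : Measure V) :=
    (locallyIntegrableOn_indicator_iff h₂.1).2 h₂.neg.2.2.2.1
  -- the difference current `D = 𝓗^m ∧ (η₁ + η₂) = [W₁, θ₁, ξ₁] - [W₂, θ₂, ξ₂]`
  set D : Current U m := vectorCurrent (μHE[m] : Measure V) (η₁ + η₂) with hD
  have hDeq : D = currentOfIntegration W₁ θ₁ ξ₁ - currentOfIntegration W₂ θ₂ ξ₂ := by
    rw [hD, vectorCurrent_add hl₁ hl₂, hη₁, hη₂, ← currentOfIntegration_eq_vectorCurrent_indicator h₁.1,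
      ← currentOfIntegration_eq_vectorCurrent_indicator h₂.1, currentOfIntegration_neg, sub_eq_add_neg]
  -- `D` vanishes on forms supported in `O`, hence has no support there
  have hD0 : ∀ φ : TestForm U m, tsupport ⇑φ ⊆ O → D φ = 0 := fun φ hφ => by
    rw [hDeq, sub_apply, h φ hφ, sub_self]
  have hspt : ∀ x ∈ O, x ∉ D.support := fun x hx =>
    D.notMem_support_of_forall_apply_eq_zero hO hD0 hx
  -- the density of `D` vanishes a.e. off its support
  have hl : LocallyIntegrableOn (η₁ + η₂) (U : Set V) (μHE[m] : Measure V) := hl₁.add hl₂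
  have hae := ae_eq_zero_of_mem_sdiff_support_vectorCurrent (Ω := U) (m := m) hl
  filter_upwards [hae] with x hx hxO hxU
  have h0 : η₁ x + η₂ x = 0 := hx ⟨hxU, hspt x hxO⟩
  have h2 : η₂ x = -W₂.indicator (fun x => (θ₂ x : ℝ) • frameVector (ξ₂ x)) x := by
    rw [hη₂]
    by_cases hx2 : x ∈ W₂
    · rw [indicator_of_mem hx2, indicator_of_mem hx2, Int.cast_neg, neg_smul]
    · rw [indicator_of_notMem hx2, indicator_of_notMem hx2, neg_zero]
  have h1 : η₁ x = -η₂ x := eq_neg_of_add_eq_zero_left h0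
  rw [h1, h2, neg_neg]

end Uniqueness

/-! ### Gluing -/

section Gluing

variable {V : Type*} [NormedAddCommGroup V] [InnerProductSpace ℝ V] [FiniteDimensional ℝ V]
  [MeasurableSpace V] [BorelSpace V] {U : Opens V} {m : ℕ}

omit [FiniteDimensional ℝ V] in
/-- Local integrability of a density passes to sub-carriers. [folklore] -/
private theorem locallyIntegrableOn_restrict_mono {W W' : Set V} (hsub : W' ⊆ W)
    {η : V → Multivector V m}
    (hint : LocallyIntegrableOn η (U : Set V) ((μHE[m] : Measure V).restrict W)) :
    LocallyIntegrableOn η (U : Set V) ((μHE[m] : Measure V).restrict W') := fun x hx => by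
  obtain ⟨S, hS, hi⟩ := hint x hx
  exact ⟨S, hS, hi.mono_measure (Measure.restrict_mono hsub le_rfl)⟩

omit [FiniteDimensional ℝ V] in
/-- A current of integration tested on a form supported in `O` only sees the part of its carrier
in `O`: `[W, θ, ξ](φ) = [W ∩ O, θ, ξ](φ)` for `spt φ ⊆ O` and locally integrable data.
[cite: Federer1969, 4.1.28 (4) with 4.1.7] -/
theorem currentOfIntegration_apply_eq_inter_of_tsupport_subset {W O : Set V} (hW : MeasurableSet W)
    {θ : V → ℤ} {ξ : V → Fin m → V}
    (hint : LocallyIntegrableOn (fun x => (θ x : ℝ) • frameVector (ξ x)) (U : Set V)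
      ((μHE[m] : Measure V).restrict W))
    (φ : TestForm U m) (hφ : tsupport ⇑φ ⊆ O) :
    currentOfIntegration W θ ξ φ = (currentOfIntegration (W ∩ O) θ ξ : Current U m) φ := by
  rw [currentOfIntegration_apply hint,
    currentOfIntegration_apply (locallyIntegrableOn_restrict_mono inter_subset_left hint)]
  refine setIntegral_eq_of_subset_of_forall_sdiff_eq_zero hW inter_subset_left ?_
  rintro x ⟨hxW, hx⟩
  have hxO : x ∉ O := fun h => hx ⟨hxW, h⟩
  rw [image_eq_zero_of_notMem_tsupport fun h => hxO (hφ h)]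
  simp

/-- **Gluing locally given rectifiable data** (Federer's local definition 4.1.24 of `𝓡^{loc}_m`
versus the integral representation 4.1.28 (4)). Let `T` be a current on `U`, `W ⊆ U` measurable.
Suppose every point of `W` has an open neighbourhood `O` and admissible data `(W ∩ O, θ_O, ξ_O)`
on `U` with `T(φ) = [W ∩ O, θ_O, ξ_O](φ)` whenever `spt φ ⊆ O`, and every point of `U ∖ W` has an
open neighbourhood disjoint from `W` on whose test forms `T` vanishes. Then `T = [W, θ, ξ]` for one
admissible triple `(W, θ, ξ)` on `U`; in particular `T ∈ 𝓡^{loc}_m(U)`. (A countable subcover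
`(Oₙ)` by Lindelöf; on `W ∩ Oₙ ∖ ⋃_{k<n} O_k` take the data of `Oₙ`; on the overlaps the local
densities agree almost everywhere by `ae_indicator_eq_of_currentOfIntegration_apply_eq`, and
approximate tangent cones are local, `approxTangentCone_restrict_inter_eq_of_isOpen`.)
[cite: Federer1969, 4.1.24, 4.1.28 (4); Simon1983, §27] -/
theorem Current.exists_isRectifiableData_of_locally (T : Current U m) {W : Set V}
    (hWm : MeasurableSet W) (hWU : W ⊆ (U : Set V))
    (hloc : ∀ x ∈ W, ∃ O : Set V, IsOpen O ∧ x ∈ O ∧ ∃ (θ : V → ℤ) (ξ : V → Fin m → V),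
      IsRectifiableData U m (W ∩ O) θ ξ ∧
      ∀ φ : TestForm U m, tsupport ⇑φ ⊆ O → T φ = currentOfIntegration (W ∩ O) θ ξ φ)
    (hoff : ∀ x ∈ (U : Set V), x ∉ W → ∃ O : Set V, IsOpen O ∧ x ∈ O ∧ Disjoint O W ∧
      ∀ φ : TestForm U m, tsupport ⇑φ ⊆ O → T φ = 0) :
    ∃ (θ : V → ℤ) (ξ : V → Fin m → V), IsRectifiableData U m W θ ξ ∧
      T = currentOfIntegration W θ ξ := by
  classical
  set μ : Measure V := μHE[m] with hμ
  -- the case `W = ∅`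
  by_cases hW0 : W = ∅
  · subst hW0
    refine ⟨fun _ => 0, fun _ _ => 0, isRectifiableData_empty, ?_⟩
    rw [currentOfIntegration_empty]
    refine T.eq_zero_of_forall_exists_nhds fun x hx => ?_
    obtain ⟨O, hO, hxO, -, hT⟩ := hoff x hx (notMem_empty x)
    exact ⟨O, hO.mem_nhds hxO, hT⟩
  -- local data and a countable subcover
  choose! O hOo hxO θl ξl hdat hTl using hloc
  obtain ⟨D, hDW, hDc, hWD⟩ : ∃ D ⊆ W, D.Countable ∧ W ⊆ ⋃ x ∈ D, O x :=
    TopologicalSpace.countable_cover_nhdsWithin fun x hx =>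
      mem_nhdsWithin_of_mem_nhds ((hOo x hx).mem_nhds (hxO x hx))
  have hDne : D.Nonempty := by
    by_contra hD
    rw [not_nonempty_iff_eq_empty] at hD
    rw [hD, biUnion_empty] at hWD
    exact hW0 (subset_empty_iff.1 hWD)
  obtain ⟨xs, hxs⟩ := hDc.exists_eq_range hDne
  have hxsW : ∀ n, xs n ∈ W := fun n => hDW (hxs ▸ mem_range_self n)
  set On : ℕ → Set V := fun n => O (xs n) with hOn
  have hOno : ∀ n, IsOpen (On n) := fun n => hOo _ (hxsW n)
  have hcover : W ⊆ ⋃ n, On n := fun x hx => by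
    obtain ⟨y, hy, hxy⟩ := mem_iUnion₂.1 (hWD hx)
    rw [hxs] at hy
    obtain ⟨n, rfl⟩ := hy
    exact mem_iUnion.2 ⟨n, hxy⟩
  have hdatn : ∀ n, IsRectifiableData U m (W ∩ On n) (θl (xs n)) (ξl (xs n)) := fun n =>
    hdat _ (hxsW n)
  have hTn : ∀ n, ∀ φ : TestForm U m, tsupport ⇑φ ⊆ On n →
      T φ = currentOfIntegration (W ∩ On n) (θl (xs n)) (ξl (xs n)) φ := fun n => hTl _ (hxsW n)
  -- the glued data: on `W ∩ Oₙ ∖ ⋃_{k<n} O_k` the data of `Oₙ`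
  have hex : ∀ x ∈ W, ∃ n, x ∈ On n := fun x hx => mem_iUnion.1 (hcover hx)
  set θ : V → ℤ := fun x => if h : ∃ n, x ∈ On n then θl (xs (Nat.find h)) x else 0 with hθ
  set ξ : V → Fin m → V := fun x => if h : ∃ n, x ∈ On n then ξl (xs (Nat.find h)) x else fun _ => 0
    with hξ
  set g : V → Multivector V m := fun x => (θ x : ℝ) • frameVector (ξ x) with hg
  -- the local densities, extended by zero
  set gl : ℕ → V → Multivector V m := fun n =>
    (W ∩ On n).indicator fun x => (θl (xs n) x : ℝ) • frameVector (ξl (xs n) x) with hgl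
  -- uniqueness on the overlaps
  have huniq : ∀ᵐ x ∂μ, ∀ j n, x ∈ On j ∩ On n → x ∈ (U : Set V) → gl j x = gl n x := by
    rw [ae_all_iff]; intro j
    rw [ae_all_iff]; intro n
    exact ae_indicator_eq_of_currentOfIntegration_apply_eq ((hOno j).inter (hOno n)) (hdatn j)
      (hdatn n) fun φ hφ => by
        rw [← hTn j φ (hφ.trans inter_subset_left), ← hTn n φ (hφ.trans inter_subset_right)]
  -- KEY: on `W ∩ Oₙ` the glued density is the local one, almost everywhere
  have hkey : ∀ᵐ x ∂μ, ∀ n, x ∈ W ∩ On n → g x = gl n x := by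
    filter_upwards [huniq] with x hx n hxn
    have hexx : ∃ k, x ∈ On k := ⟨n, hxn.2⟩
    have hxk : x ∈ On (Nat.find hexx) := Nat.find_spec hexx
    have hgx : g x = gl (Nat.find hexx) x := by
      simp only [hg, hθ, hξ, hexx, dif_pos, hgl,
        indicator_of_mem (show x ∈ W ∩ On (Nat.find hexx) from ⟨hxn.1, hxk⟩)]
    rw [hgx]
    exact hx _ n ⟨hxk, hxn.2⟩ (hWU hxn.1)
  have hkey' : ∀ n, ∀ᵐ x ∂μ, x ∈ W ∩ On n →
      g x = (θl (xs n) x : ℝ) • frameVector (ξl (xs n) x) := fun n => by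
    filter_upwards [hkey] with x hx hxn
    rw [hx n hxn]
    simp only [hgl, indicator_of_mem hxn]
  -- local integrability of the glued density
  have hgint : LocallyIntegrableOn g (U : Set V) (μ.restrict W) := by
    intro x hxU
    by_cases hxO : ∃ n, x ∈ On n
    · obtain ⟨n, hxn⟩ := hxO
      obtain ⟨S, hS, hi⟩ := (hdatn n).2.2.2.1 x hxU
      -- an open `S₀ ∋ x` with `S₀ ∩ U ⊆ S`
      obtain ⟨S₀, hS₀S, hS₀o, hxS₀⟩ : ∃ S₀ : Set V, S₀ ∩ (U : Set V) ⊆ S ∧ IsOpen S₀ ∧ x ∈ S₀ := by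
        obtain ⟨S₁, hS₁, hS12⟩ := mem_nhdsWithin_iff_exists_mem_nhds_inter.1 hS
        obtain ⟨S₀, hS₀1, hS₀o, hxS₀⟩ := mem_nhds_iff.1 hS₁
        exact ⟨S₀, fun y hy => hS12 ⟨hS₀1 hy.1, hy.2⟩, hS₀o, hxS₀⟩
      set S' : Set V := S₀ ∩ (U : Set V) ∩ On n with hS'
      have hS'm : MeasurableSet S' :=
        (hS₀o.measurableSet.inter U.isOpen.measurableSet).inter (hOno n).measurableSet
      have hS'nhds : S' ∈ 𝓝[(U : Set V)] x := by
        rw [hS', inter_comm S₀, inter_assoc]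
        exact inter_mem_nhdsWithin _ ((hS₀o.inter (hOno n)).mem_nhds ⟨hxS₀, hxn⟩)
      refine ⟨S', hS'nhds, ?_⟩
      have hi' : IntegrableOn (fun x => (θl (xs n) x : ℝ) • frameVector (ξl (xs n) x)) S'
          (μ.restrict (W ∩ On n)) := hi.mono_set fun y hy => hS₀S hy.1
      rw [IntegrableOn, Measure.restrict_restrict hS'm] at hi' ⊢
      have hset : S' ∩ (W ∩ On n) = S' ∩ W := by
        rw [hS']; ext y; constructor
        · rintro ⟨hy, hyW, -⟩; exact ⟨hy, hyW⟩
        · rintro ⟨hy, hyW⟩; exact ⟨hy, hyW, hy.2⟩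
      rw [hset] at hi'
      refine hi'.congr ?_
      rw [Filter.EventuallyEq, ae_restrict_iff' (hS'm.inter hWm)]
      filter_upwards [hkey' n] with y hy hyS
      exact (hy ⟨hyS.2, hyS.1.2⟩).symm
    · have hxW : x ∉ W := fun h => hxO (hex x h)
      obtain ⟨O', hO'o, hxO', hdisj, -⟩ := hoff x hxU hxW
      refine ⟨O', mem_nhdsWithin_of_mem_nhds (hO'o.mem_nhds hxO'), ?_⟩
      rw [IntegrableOn, Measure.restrict_restrict hO'o.measurableSet,
        (Set.disjoint_iff_inter_eq_empty.1 hdisj), Measure.restrict_empty]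
      exact integrable_zero_measure
  -- the glued triple is admissible
  have hdata : IsRectifiableData U m W θ ξ := by
    refine ⟨hWm, hWU, ?_, hgint, ?_⟩
    · have h := IsCountablyRectifiable.iUnion fun n => (hdatn n).2.2.1
      exact h.mono fun x hx => by
        obtain ⟨n, hn⟩ := hex x hx
        exact mem_iUnion.2 ⟨n, hx, hn⟩
    · -- frames: orthonormal, spanning the approximate tangent space, a.e.
      have hfr : ∀ k, ∀ᵐ x ∂μ, x ∈ W ∩ On k →
          Orthonormal ℝ (ξl (xs k) x) ∧
            ((Submodule.span ℝ (range (ξl (xs k) x)) : Set V) =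
              approxTangentCone m (μ.restrict (W ∩ On k)) x) := fun k =>
        (ae_restrict_iff' (hWm.inter (hOno k).measurableSet)).1 (hdatn k).2.2.2.2
      rw [← ae_all_iff] at hfr
      rw [ae_restrict_iff' hWm]
      filter_upwards [hfr] with x hx hxW
      have hexx : ∃ k, x ∈ On k := hex x hxW
      have hxk : x ∈ On (Nat.find hexx) := Nat.find_spec hexx
      have hξx : ξ x = ξl (xs (Nat.find hexx)) x := by simp only [hξ, hexx, dif_pos]
      rw [hξx]
      obtain ⟨h1, h2⟩ := hx _ ⟨hxW, hxk⟩
      refine ⟨h1, ?_⟩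
      rw [h2, hμ]
      exact approxTangentCone_restrict_inter_eq_of_isOpen _ hWm (hOno _) hxk
  refine ⟨θ, ξ, hdata, ?_⟩
  -- `T = [W, θ, ξ]`: both vanish, or agree, near every point of `U`
  rw [← sub_eq_zero]
  refine Current.eq_zero_of_forall_exists_nhds _ fun x hxU => ?_
  by_cases hxO : ∃ n, x ∈ On n
  · obtain ⟨n, hxn⟩ := hxO
    refine ⟨On n, (hOno n).mem_nhds hxn, fun φ hφ => ?_⟩
    rw [sub_apply, hTn n φ hφ, currentOfIntegration_apply_eq_inter_of_tsupport_subset hWm hgint φ hφ,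
      sub_eq_zero, currentOfIntegration_apply (hdatn n).2.2.2.1,
      currentOfIntegration_apply (locallyIntegrableOn_restrict_mono inter_subset_left hgint)]
    refine integral_congr_ae ?_
    rw [Filter.EventuallyEq, ae_restrict_iff' (hWm.inter (hOno n).measurableSet)]
    filter_upwards [hkey' n] with y hy hyn
    have := congrArg (fun M : Multivector V m => M (φ y)) (hy hyn)
    simpa [hg] using this.symm
  · have hxW : x ∉ W := fun h => hxO (hex x h)
    obtain ⟨O', hO'o, hxO', hdisj, hT0⟩ := hoff x hxU hxW
    refine ⟨O', hO'o.mem_nhds hxO', fun φ hφ => ?_⟩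
    rw [sub_apply, hT0 φ hφ, currentOfIntegration_apply_eq_inter_of_tsupport_subset hWm hgint φ hφ,
      (Set.disjoint_iff_inter_eq_empty.1 hdisj.symm), currentOfIntegration_empty]
    simp

end Gluing

end Literature.Geometry.GeometricMeasureTheory
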